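import Literature.Probability.LatticeModels.TriangularLatticeProofs
import HarnessLib

/-!
# The three ports of a honeycomb vertex point in directions `ρ, ρω, ρω²`

Topic `Literature/Probability/LatticeModels` (hexagonal lattice `hexGraph` on `HexVertex`, embedded by
`hexCenter`, `TriangularLattice.lean`). Every vertex `v` of `ℍ` has exactly three neighbours, and the
three edge vectors `c(w) - c(v)` are obtained from any one of them by the rotations `ω = ζ²`, `ω² = ζ⁴`
(`ζ = e^{iπ/3}`, `ω = e^{2πi/3}`). For a LABELLING `(w₀, w₁, w₂)` of the three neighbours (pairwise
distinct, all adjacent to `v`) this leaves exactly two orientation classes: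
`(c w₁ - c v, c w₂ - c v) = (ω, ω²)·(c w₀ - c v)` (counter-clockwise) or `(ω², ω)·(c w₀ - c v)`
(clockwise) — `hexStar_directions`. This is the lattice input that turns statements about the
Duminil-Copin–Smirnov vertex triple `(F{v,w₀}, F{v,w₁}, F{v,w₂})` for ALL labellings into statements
about its three `ℤ/3`-modes (Grimmett 1999 §1.6 for the lattice; folklore geometry).

Contents: `triZeta_pow_three`, `triZeta_pow_six`, the base triples `hexStar_up`, `hexStar_down`
(explicit neighbours of an up / down face in `ζ`-power form), the algebraic case lemma
`rot_cases_of_perm`, and `hexStar_directions`.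
-/

noncomputable section

namespace Literature.Probability.LatticeModels

open Complex

/-- `ζ³ = -1`. [folklore] -/
theorem triZeta_pow_three : triZeta ^ 3 = -1 := by
  linear_combination (triZeta + 1) * triZeta_sq

/-- `ζ⁶ = 1` (so `ω = ζ²` is a cube root of unity). [folklore] -/
theorem triZeta_pow_six : triZeta ^ 6 = 1 := by
  linear_combination (triZeta ^ 4 + triZeta ^ 3 - triZeta - 1) * triZeta_sq

/-- **The star of an up face**: with `a = c(x;1) - c(x;0) = (1+ζ)/3`, the other two neighbours
`(x - e₀; 1)`, `(x - e₁; 1)` of `(x; 0)` sit at `ζ² a` and `ζ⁴ a`. [folklore] -/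
theorem hexStar_up (x : Site 2) :
    hexCenter ((x, 1) : HexVertex) - hexCenter ((x, 0) : HexVertex) = (1 + triZeta) / 3 ∧
    hexCenter ((x - Pi.single 0 1, 1) : HexVertex) - hexCenter ((x, 0) : HexVertex) =
      triZeta ^ 2 * ((1 + triZeta) / 3) ∧
    hexCenter ((x - Pi.single 1 1, 1) : HexVertex) - hexCenter ((x, 0) : HexVertex) =
      triZeta ^ 4 * ((1 + triZeta) / 3) := by
  refine ⟨?_, ?_, ?_⟩
  · simp only [hexCenter, Fin.val_one, Fin.val_zero]
    push_cast
    ring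
  · simp only [hexCenter, triEmbed_sub, triEmbed_single_zero, Fin.val_one, Fin.val_zero]
    push_cast
    linear_combination (-(2 : ℂ) / 3 - triZeta / 3) * triZeta_sq
  · simp only [hexCenter, triEmbed_sub, triEmbed_single_one, Fin.val_one, Fin.val_zero]
    push_cast
    linear_combination ((1 : ℂ) / 3 - triZeta / 3 - 2 * triZeta ^ 2 / 3 - triZeta ^ 3 / 3) * triZeta_sq

/-- **The star of a down face**: with `a = c(x;0) - c(x;1) = -(1+ζ)/3`, the other two neighbours
`(x + e₀; 0)`, `(x + e₁; 0)` of `(x; 1)` sit at `ζ² a` and `ζ⁴ a`. [folklore] -/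
theorem hexStar_down (x : Site 2) :
    hexCenter ((x, 0) : HexVertex) - hexCenter ((x, 1) : HexVertex) = -((1 + triZeta) / 3) ∧
    hexCenter ((x + Pi.single 0 1, 0) : HexVertex) - hexCenter ((x, 1) : HexVertex) =
      triZeta ^ 2 * -((1 + triZeta) / 3) ∧
    hexCenter ((x + Pi.single 1 1, 0) : HexVertex) - hexCenter ((x, 1) : HexVertex) =
      triZeta ^ 4 * -((1 + triZeta) / 3) := by
  refine ⟨?_, ?_, ?_⟩
  · simp only [hexCenter, Fin.val_one, Fin.val_zero]
    push_cast
    ring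
  · simp only [hexCenter, triEmbed_add, triEmbed_single_zero, Fin.val_one, Fin.val_zero]
    push_cast
    linear_combination ((2 : ℂ) / 3 + triZeta / 3) * triZeta_sq
  · simp only [hexCenter, triEmbed_add, triEmbed_single_one, Fin.val_one, Fin.val_zero]
    push_cast
    linear_combination (-((1 : ℂ) / 3 - triZeta / 3 - 2 * triZeta ^ 2 / 3 - triZeta ^ 3 / 3)) * triZeta_sq

/-- The algebraic case lemma: if `(d₀, d₁, d₂)` is a permutation of `(a, ζ²a, ζ⁴a)` and `ζ⁶ = 1`,
then `(d₁, d₂) = (ζ² d₀, ζ⁴ d₀)` or `(d₁, d₂) = (ζ⁴ d₀, ζ² d₀)`. [folklore] -/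
theorem rot_cases_of_perm {ζ a d₀ d₁ d₂ : ℂ} (hz : ζ ^ 6 = 1)
    (h : (d₀ = a ∧ d₁ = ζ ^ 2 * a ∧ d₂ = ζ ^ 4 * a) ∨ (d₀ = a ∧ d₁ = ζ ^ 4 * a ∧ d₂ = ζ ^ 2 * a) ∨
      (d₀ = ζ ^ 2 * a ∧ d₁ = a ∧ d₂ = ζ ^ 4 * a) ∨ (d₀ = ζ ^ 2 * a ∧ d₁ = ζ ^ 4 * a ∧ d₂ = a) ∨
      (d₀ = ζ ^ 4 * a ∧ d₁ = a ∧ d₂ = ζ ^ 2 * a) ∨ (d₀ = ζ ^ 4 * a ∧ d₁ = ζ ^ 2 * a ∧ d₂ = a)) :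
    (d₁ = ζ ^ 2 * d₀ ∧ d₂ = ζ ^ 4 * d₀) ∨ (d₁ = ζ ^ 4 * d₀ ∧ d₂ = ζ ^ 2 * d₀) := by
  rcases h with ⟨h0, h1, h2⟩ | ⟨h0, h1, h2⟩ | ⟨h0, h1, h2⟩ | ⟨h0, h1, h2⟩ | ⟨h0, h1, h2⟩ | ⟨h0, h1, h2⟩ <;>
    rw [h0, h1, h2]
  · exact Or.inl ⟨rfl, rfl⟩
  · exact Or.inr ⟨rfl, rfl⟩
  · exact Or.inr ⟨by linear_combination (-a) * hz, by ring⟩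
  · exact Or.inl ⟨by ring, by linear_combination (-a) * hz⟩
  · exact Or.inl ⟨by linear_combination (-a) * hz, by linear_combination (-(ζ ^ 2 * a)) * hz⟩
  · exact Or.inr ⟨by linear_combination (-(ζ ^ 2 * a)) * hz, by linear_combination (-a) * hz⟩

/-- The two orientation classes of a labelled star at an UP face `(x; 0)`. [folklore] -/
theorem hexStar_directions_up (x : Site 2) {w₀ w₁ w₂ : HexVertex}
    (h₀ : hexGraph.Adj ((x, 0) : HexVertex) w₀) (h₁ : hexGraph.Adj ((x, 0) : HexVertex) w₁)
    (h₂ : hexGraph.Adj ((x, 0) : HexVertex) w₂) (h01 : w₀ ≠ w₁) (h12 : w₁ ≠ w₂) (h02 : w₀ ≠ w₂) :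
    (hexCenter w₁ - hexCenter (x, 0) = triZeta ^ 2 * (hexCenter w₀ - hexCenter (x, 0)) ∧
      hexCenter w₂ - hexCenter (x, 0) = triZeta ^ 4 * (hexCenter w₀ - hexCenter (x, 0))) ∨
    (hexCenter w₁ - hexCenter (x, 0) = triZeta ^ 4 * (hexCenter w₀ - hexCenter (x, 0)) ∧
      hexCenter w₂ - hexCenter (x, 0) = triZeta ^ 2 * (hexCenter w₀ - hexCenter (x, 0))) := by
  obtain ⟨eA, eB, eC⟩ := hexStar_up x
  have H : ∀ {w : HexVertex}, hexGraph.Adj ((x, 0) : HexVertex) w →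
      w = ((x, 1) : HexVertex) ∨ w = ((x - Pi.single 0 1, 1) : HexVertex) ∨
        w = ((x - Pi.single 1 1, 1) : HexVertex) := by
    rintro ⟨y, l⟩ h
    fin_cases l
    · exact absurd h (not_hexGraph_adj_of_snd_eq_holds _ _ rfl)
    · rcases (hexGraph_adj_iff_of_snd_eq_zero_holds x y).1 h with rfl | rfl | rfl
      · exact Or.inl rfl
      · exact Or.inr (Or.inl rfl)
      · exact Or.inr (Or.inr rfl)
  refine rot_cases_of_perm (a := (1 + triZeta) / 3) triZeta_pow_six ?_
  rcases H h₀ with rfl | rfl | rfl <;> rcases H h₁ with rfl | rfl | rfl <;>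
    rcases H h₂ with rfl | rfl | rfl <;>
    first
    | exact absurd rfl h01
    | exact absurd rfl h12
    | exact absurd rfl h02
    | simp only [eA, eB, eC, true_and, and_true, true_or, or_true]

/-- The two orientation classes of a labelled star at a DOWN face `(x; 1)`. [folklore] -/
theorem hexStar_directions_down (x : Site 2) {w₀ w₁ w₂ : HexVertex}
    (h₀ : hexGraph.Adj ((x, 1) : HexVertex) w₀) (h₁ : hexGraph.Adj ((x, 1) : HexVertex) w₁)
    (h₂ : hexGraph.Adj ((x, 1) : HexVertex) w₂) (h01 : w₀ ≠ w₁) (h12 : w₁ ≠ w₂) (h02 : w₀ ≠ w₂) :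
    (hexCenter w₁ - hexCenter (x, 1) = triZeta ^ 2 * (hexCenter w₀ - hexCenter (x, 1)) ∧
      hexCenter w₂ - hexCenter (x, 1) = triZeta ^ 4 * (hexCenter w₀ - hexCenter (x, 1))) ∨
    (hexCenter w₁ - hexCenter (x, 1) = triZeta ^ 4 * (hexCenter w₀ - hexCenter (x, 1)) ∧
      hexCenter w₂ - hexCenter (x, 1) = triZeta ^ 2 * (hexCenter w₀ - hexCenter (x, 1))) := by
  obtain ⟨eA, eB, eC⟩ := hexStar_down x
  have H : ∀ {w : HexVertex}, hexGraph.Adj ((x, 1) : HexVertex) w →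
      w = ((x, 0) : HexVertex) ∨ w = ((x + Pi.single 0 1, 0) : HexVertex) ∨
        w = ((x + Pi.single 1 1, 0) : HexVertex) := by
    rintro ⟨y, l⟩ h
    fin_cases l
    · rcases (hexGraph_adj_iff_of_snd_eq_one x y).1 h with rfl | rfl | rfl
      · exact Or.inl rfl
      · exact Or.inr (Or.inl rfl)
      · exact Or.inr (Or.inr rfl)
    · exact absurd h (not_hexGraph_adj_of_snd_eq_holds _ _ rfl)
  refine rot_cases_of_perm (a := -((1 + triZeta) / 3)) triZeta_pow_six ?_
  rcases H h₀ with rfl | rfl | rfl <;> rcases H h₁ with rfl | rfl | rfl <;>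
    rcases H h₂ with rfl | rfl | rfl <;>
    first
    | exact absurd rfl h01
    | exact absurd rfl h12
    | exact absurd rfl h02
    | simp only [eA, eB, eC, true_and, and_true, true_or, or_true]

/-- **The two orientation classes of a labelled star.** If `w₀, w₁, w₂` are pairwise distinct
neighbours of `v` in `ℍ`, then either `c w₁ - c v = ζ²(c w₀ - c v)` and `c w₂ - c v = ζ⁴(c w₀ - c v)`
(counter-clockwise labelling) or `c w₁ - c v = ζ⁴(c w₀ - c v)` and `c w₂ - c v = ζ²(c w₀ - c v)`
(clockwise labelling); `ζ² = e^{2πi/3}`. [folklore] -/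
theorem hexStar_directions {v w₀ w₁ w₂ : HexVertex} (h₀ : hexGraph.Adj v w₀) (h₁ : hexGraph.Adj v w₁)
    (h₂ : hexGraph.Adj v w₂) (h01 : w₀ ≠ w₁) (h12 : w₁ ≠ w₂) (h02 : w₀ ≠ w₂) :
    (hexCenter w₁ - hexCenter v = triZeta ^ 2 * (hexCenter w₀ - hexCenter v) ∧
      hexCenter w₂ - hexCenter v = triZeta ^ 4 * (hexCenter w₀ - hexCenter v)) ∨
    (hexCenter w₁ - hexCenter v = triZeta ^ 4 * (hexCenter w₀ - hexCenter v) ∧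
      hexCenter w₂ - hexCenter v = triZeta ^ 2 * (hexCenter w₀ - hexCenter v)) := by
  obtain ⟨x, i⟩ := v
  fin_cases i
  · exact hexStar_directions_up x h₀ h₁ h₂ h01 h12 h02
  · exact hexStar_directions_down x h₀ h₁ h₂ h01 h12 h02

end Literature.Probability.LatticeModels

end
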